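import Summits.BirchSwinnertonDyer.BirchSwinnertonDyer.Theorems.ResidualThetaTransportAtTwoSignedMuVanishingAtTwoPlusMultOneSocle
import Literature.NumberTheory.EllipticCurves.PeriodHomologyIntersectionPairing
import Literature.NumberTheory.EllipticCurves.ModularSymbolsPeriodHomology
import Mathlib.LinearAlgebra.FreeModule.PID
import Mathlib.Algebra.Module.Projective
import HarnessLib

/-!
# Route `ResidualThetaTransportAtTwo`, crux Kμ⁺ `SignedMuVanishingAtTwoPlus` (stmt-BirchSwinnertonDyer-20689), line
# `birth`, stub `stub_flatMuZeroAtTwo`: the (MO⁺) DICTIONARY, part 3 — from SOCLE to CHARACTERS through a Hecke-self-adjoint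
# perfect pairing on `Λ = H₁(X₀(N); ℤ)`: hypothesis (I) «at most four mod-2 eigencharacters» of `…MultOneFlat`

Cell `bsd-wall`, width seat `bsd-wall-rtt-p4-w2` (g4). THEOREMS ONLY (no `def`, no `sorry`). The one new named fact used —
`periodHomology_exists_heckeSelfAdjoint_perfectPairing` (`Literature/…/PeriodHomologyIntersectionPairing.lean`: the
Hecke-self-adjoint perfect pairing on the period homology = Poincaré duality on `X₀(N)(ℂ)` twisted by the Atkin–Lehner
involution `w_N`; Merel 1995, Diamond–Im 1995 Rem. 10.2.2 as used by Agashe–Ribet–Stein 2011 §3) — and Buzzard's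
multiplicity one enter as explicit hypotheses `hPair`, `hBuz`. Helper `--supports` the crux; closes nothing. BSD is not proved
by this.

## What is proved
* `exists_socleRep_of_pairing` — granted a perfect pairing `B : Λ × Λ → ℤ` (`x ↦ B x` bijective onto `Hom(Λ, ℤ)`) for which the
  dual Hecke action is self-adjoint: every map `χ : Γ₀(N) → ZMod 2` that is additive, factors through the period functional and
  is a Hecke eigencharacter with the eigenvalues `A p = a_p(f)` of a newform `f` (integer eigenvalues) at ALL primes is
  REPRESENTED by a mod-2 eigenvector: `χ(γ) = B(x₀, {∞,γ∞}) mod 2` for some `x₀ ∈ Λ` with `T_p^∨ x₀ − (A p) x₀ ∈ 2Λ` for all `p`.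
  (Lift `χ` to `Λ → ℤ` — `Λ` is a finitely generated torsion-free, hence free, `ℤ`-module — invert `B`, and use
  self-adjointness + perfectness to see that `B((T_p − A p) x₀, ·) ∈ 2 Hom(Λ, ℤ)` forces `(T_p − A p) x₀ ∈ 2Λ`.)
* `card_eigenChar_le_four` — hence, with part 2 (`card_le_four_of_multiplicityOne`: at most `4` classes of mod-2 eigenvectors
  mod `2Λ`, from `buzzard2000_multiplicityOne_gamma0` and its Galois hypotheses at `𝔪_f`), every finite set of such `χ` has at
  most `4` elements — hypothesis (I) `hfour` of `…MultOneFlat.multOnePlus_of_card_le_four` / `flatAtTwo_of_card_le_four`.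

References: L. Merel, *Homologie des courbes modulaires affines et paramétrisations modulaires*, in Elliptic Curves, Modular
Forms & Fermat's Last Theorem (Hong Kong 1993), Int. Press 1995, §1.2–1.3, §2.1–2.3 [Merel1995Homologie]; F. Diamond, J. Im,
*Modular forms and modular curves* (1995) Rem. 10.2.2 [DiamondIm1995]; A. Agashe, K. Ribet, W. Stein, *The modular degree,
congruence primes, and multiplicity one* (2011/12) §2.2, §3 [AgasheRibetStein2011]; H. Darmon, F. Diamond, R. Taylor, *Fermat's Last
Theorem* §1.3 [DarmonDiamondTaylor1995]; K. Buzzard, Math. Res. Lett. 7 (2000) Prop. 2.4 [Buzzard2000LevelLoweringModTwo].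
-/

set_option autoImplicit false
set_option linter.dupNamespace false

noncomputable section

open scoped Classical MatrixGroups ModularForm NumberField

open CongruenceSubgroup Polynomial IsDedekindDomain Literature.NumberTheory.EllipticCurves
  Literature.NumberTheory.EllipticCurves.ModularForms Literature.NumberTheory.GaloisRepresentations Rat.HeightOneSpectrum

namespace Summit.BirchSwinnertonDyer.BirchSwinnertonDyer.Theorems.SignedMuAtTwo

namespace MultOneDictionary

/-! ## §1. Characters are represented by mod-2 eigenvectors -/

section Represent

variable {N : ℕ} [NeZero N]

/-- The period homology `Λ` (as the `𝕋_ℤ`-module `periodHomologyHecke N`) is a finitely generated `ℤ`-module (the tree's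
`periodHomology_fg`; Darmon–Diamond–Taylor §1.3 p. 27 "`Λ` is a lattice in `V`"). [cite: DarmonDiamondTaylor1995, §1.3 (p. 27)] -/
theorem moduleFinite_int_periodHomologyHecke : Module.Finite ℤ (periodHomologyHecke N) := by
  rw [Module.Finite.iff_addGroup_fg]
  haveI hfg : AddGroup.FG (periodHomology N) := (AddGroup.fg_iff_addSubgroup_fg _).mpr periodHomology_fg
  let e : periodHomology N →+ periodHomologyHecke N :=
    { toFun := fun x ↦ ⟨x.1, (mem_periodHomologyHecke N).mpr x.2⟩
      map_zero' := rfl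
      map_add' := fun _ _ ↦ rfl }
  exact AddGroup.fg_of_surjective (f := e) fun y ↦ ⟨⟨y.1, (mem_periodHomologyHecke N).mp y.2⟩, rfl⟩

/-- `Λ ⊆ S₂(Γ₀(N))^∨` is torsion-free as a `ℤ`-module (a subgroup of a complex vector space). [folklore] -/
theorem noZeroSMulDivisors_int_periodHomologyHecke : NoZeroSMulDivisors ℤ (periodHomologyHecke N) := by
  refine ⟨fun {n x} h ↦ ?_⟩
  have h' : (n : ℂ) • (x : Module.Dual ℂ (CuspForm (Gamma0 N) 2)) = 0 := by
    rw [Int.cast_smul_eq_zsmul, ← Submodule.coe_smul_of_tower, h, Submodule.coe_zero]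
  rcases smul_eq_zero.mp h' with h1 | h1
  · exact Or.inl (by exact_mod_cast h1)
  · exact Or.inr (Subtype.ext h1)

/-- **Every mod-2 Hecke eigencharacter through the period functional is represented by a mod-2 eigenvector** (granted a
Hecke-self-adjoint perfect pairing `B` on `Λ`). Let `A p ∈ ℤ` (`p` prime; in the application the Hecke eigenvalues of
a newform) and `χ : Γ₀(N) → ZMod 2` additive, factoring through `γ ↦ {∞, γ∞}`, with `χ σ = (A p) χ γ` whenever
`{∞,σ∞} = T_p^∨{∞,γ∞}` (all primes `p`). Then there is `x₀ ∈ Λ` with `χ γ = B(x₀, {∞,γ∞}) mod 2` for all `γ` and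
`T_p^∨ x₀ − (A p) x₀ ∈ 2Λ` for every prime `p`. Proof: `χ` descends to `χ̃ : Λ → 𝔽₂` (Manin: `Λ` consists of period
functionals); `Λ` is free over `ℤ`, so `χ̃` lifts to `ψ : Λ → ℤ`, and `ψ = B(x₀, ·)` by perfectness; `χ̃(T_p^∨ y) = (A p) χ̃(y)`
and self-adjointness give `B((T_p − A p) x₀, ·) ≡ 0 (mod 2)`, i.e. `= 2 B(x₁, ·) = B(2x₁, ·)`, so `(T_p − A p) x₀ = 2 x₁`.
[cite: Merel1995Homologie, §1.2–1.3 and §2.1–2.3] [cite: AgasheRibetStein2011, §3] [cite: DarmonDiamondTaylor1995, §1.3] -/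
theorem exists_socleRep_of_pairing (B : periodHomologyHecke N →+ periodHomologyHecke N →+ ℤ)
    (hBij : Function.Bijective B) (hAdj : ∀ (t : HeckeRing0 N 2) (x y : periodHomologyHecke N), B (t • x) y = B x (t • y))
    (A : ℕ → ℤ) (χ : Gamma0 N → ZMod 2)
    (ha : ∀ γ γ' : Gamma0 N, χ (γ * γ') = χ γ + χ γ')
    (hb : ∀ γ γ' : Gamma0 N, periodFunctional N γ = periodFunctional N γ' → χ γ = χ γ')
    (hd : ∀ (p : ℕ) (hp : p.Prime) (γ σ : Gamma0 N),
      periodFunctional N σ = (haveI : NeZero p := ⟨hp.ne_zero⟩; heckeT (Gamma0 N) 2 p).dualMap (periodFunctional N γ) →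
      χ σ = ((A p : ℤ) : ZMod 2) * χ γ) :
    ∃ x₀ : periodHomologyHecke N,
      (∀ γ : Gamma0 N, χ γ = ((B x₀ ⟨periodFunctional N γ, periodFunctional_mem_periodHomology N γ⟩ : ℤ) : ZMod 2)) ∧
      ∀ (p : ℕ) (hp : p.Prime), ∃ y ∈ periodHomology N,
        (haveI : NeZero p := ⟨hp.ne_zero⟩; heckeT (Gamma0 N) 2 p).dualMap (x₀ : Module.Dual ℂ (CuspForm (Gamma0 N) 2))
          - ((A p : ℤ) : ℂ) • (x₀ : Module.Dual ℂ (CuspForm (Gamma0 N) 2)) = (2 : ℂ) • y := by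
  classical
  haveI : Module.Finite ℤ (periodHomologyHecke N) := moduleFinite_int_periodHomologyHecke
  haveI : NoZeroSMulDivisors ℤ (periodHomologyHecke N) := noZeroSMulDivisors_int_periodHomologyHecke
  -- `Λ` consists of period functionals
  have hsurj : ∀ x : periodHomologyHecke N, ∃ γ : Gamma0 N, periodFunctional N γ = x := by
    intro x
    have hx : (x : Module.Dual ℂ (CuspForm (Gamma0 N) 2)) ∈ (periodHomology N : Set _) := x.2
    rw [coe_periodHomology_eq_range] at hx
    exact hx
  choose γof hγof using hsurj
  have hχ1 : χ 1 = 0 := by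
    have h := ha 1 1
    rw [mul_one] at h
    have h2 : χ 1 + χ 1 = 0 := ZModModule.add_self _
    rw [← h] at h2
    exact h2
  -- the descended character `χ̃ : Λ →+ ZMod 2`
  let χt : periodHomologyHecke N →+ ZMod 2 :=
    { toFun := fun x ↦ χ (γof x)
      map_zero' := by
        have h : periodFunctional N (γof 0) = periodFunctional N 1 := by rw [hγof, periodFunctional_one]; rfl
        rw [hb _ _ h, hχ1]
      map_add' := fun x y ↦ by
        have h : periodFunctional N (γof (x + y)) = periodFunctional N (γof x * γof y) := by
          rw [periodFunctional_mul, hγof, hγof, hγof]; rfl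
        rw [hb _ _ h, ha] }
  have hχt : ∀ x, χt x = χ (γof x) := fun _ ↦ rfl
  have hχt_per : ∀ γ : Gamma0 N, χt ⟨periodFunctional N γ, periodFunctional_mem_periodHomology N γ⟩ = χ γ := by
    intro γ
    rw [hχt]
    exact hb _ _ (hγof _)
  have hχt_hecke : ∀ (p : ℕ) (hp : p.Prime) (y : periodHomologyHecke N),
      χt (HeckeRing0.T N 2 p hp • y) = ((A p : ℤ) : ZMod 2) * χt y := by
    intro p hp y
    rw [hχt, hχt]
    apply hd p hp
    rw [hγof, hγof, Submodule.coe_smul]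
    rfl
  -- lift `χ̃` to `ψ : Λ →ₗ[ℤ] ℤ` (Λ is free over ℤ)
  have hcast : Function.Surjective ((Int.castAddHom (ZMod 2)).toIntLinearMap : ℤ →ₗ[ℤ] ZMod 2) := by
    intro c
    exact ⟨(c.val : ℤ), by simp⟩
  obtain ⟨ψ, hψ⟩ := Module.projective_lifting_property ((Int.castAddHom (ZMod 2)).toIntLinearMap) χt.toIntLinearMap hcast
  have hψ' : ∀ x, ((ψ x : ℤ) : ZMod 2) = χt x := fun x ↦ by
    have := LinearMap.congr_fun hψ x
    simpa using this
  -- `ψ = B x₀`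
  obtain ⟨x₀, hx₀⟩ := hBij.2 ψ.toAddMonoidHom
  have hx₀' : ∀ y, B x₀ y = ψ y := fun y ↦ by rw [hx₀]; rfl
  refine ⟨x₀, fun γ ↦ by rw [hx₀', hψ', hχt_per], fun p hp ↦ ?_⟩
  -- `(T_p − A p) x₀ ∈ 2Λ`
  haveI : NeZero p := ⟨hp.ne_zero⟩
  set d : periodHomologyHecke N := HeckeRing0.T N 2 p hp • x₀ - (A p : ℤ) • x₀ with hd_def
  have heven : ∀ y, ∃ m : ℤ, B d y = 2 * m := by
    intro y
    have h1 : B d y = ψ (HeckeRing0.T N 2 p hp • y) - A p * ψ y := by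
      rw [hd_def, map_sub, AddMonoidHom.sub_apply, hAdj, map_zsmul, AddMonoidHom.zsmul_apply, smul_eq_mul, hx₀', hx₀']
    have h2 : ((B d y : ℤ) : ZMod 2) = 0 := by
      rw [h1, Int.cast_sub, Int.cast_mul, hψ', hψ', hχt_hecke p hp y, sub_self]
    exact (ZMod.intCast_zmod_eq_zero_iff_dvd _ 2).mp h2
  choose μ hμ using heven
  let ψ' : periodHomologyHecke N →+ ℤ :=
    { toFun := μ
      map_zero' := by have h := hμ 0; rw [map_zero] at h; omega
      map_add' := fun y z ↦ by have h := hμ (y + z); rw [map_add, hμ y, hμ z] at h; omega }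
  obtain ⟨x₁, hx₁⟩ := hBij.2 ψ'
  have hd2 : d = (2 : ℤ) • x₁ := by
    apply hBij.1
    ext y
    rw [map_zsmul, AddMonoidHom.zsmul_apply, hx₁, smul_eq_mul, hμ y]
    rfl
  refine ⟨(x₁ : Module.Dual ℂ (CuspForm (Gamma0 N) 2)), x₁.2, ?_⟩
  have hcoe := congrArg (fun z : periodHomologyHecke N ↦ (z : Module.Dual ℂ (CuspForm (Gamma0 N) 2))) hd2
  simp only [hd_def, Submodule.coe_sub, Submodule.coe_smul_of_tower] at hcoe
  rw [← Int.cast_smul_eq_zsmul ℂ (A p), ← Int.cast_smul_eq_zsmul ℂ 2, Int.cast_ofNat] at hcoe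
  rw [← hcoe]
  rfl

/-- **(I) from the pairing and mod-2 multiplicity one.** Let `N` be odd and `f ∈ S₂(Γ₀(N))` a normalised newform with integer
eigenvalues `A p`. GRANT the Hecke-self-adjoint perfect pairing on `Λ` (`hPair`), Buzzard 2000 Prop. 2.4 (`hBuz`) and its
hypotheses at `𝔪_f` (a continuous `ρ : G_ℚ → GL₂(k)`, `k` algebraically closed of characteristic `2`, unramified at `v ∤ 2N`
with `charpoly ρ(Frob_v) = X² − (A p_v) X + p_v`, irreducible, non-scalar on the decomposition groups above `2`). THEN every
finite set of maps `χ : Γ₀(N) → ZMod 2` that are additive, factor through the period functional and are Hecke eigencharacters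
with eigenvalues `A p mod 2` at all primes has AT MOST `4` elements — hypothesis (I) `hfour` of
`…MultOneFlat.multOnePlus_of_card_le_four`. (Each `χ` is `B(x_χ, ·) mod 2` for a mod-2 eigenvector `x_χ`
(`exists_socleRep_of_pairing`), distinct `χ` have representatives incongruent mod `2Λ`, and there are at most `4` classes
(`card_le_four_of_multiplicityOne`).) [cite: Buzzard2000LevelLoweringModTwo, Prop. 2.4 and Def. 2.1–2.2 (p. 100–101)]
[cite: Merel1995Homologie, §1.2–1.3 and §2.1–2.3] [cite: AgasheRibetStein2011, §2.2 and §3] -/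
theorem card_eigenChar_le_four (hPair : periodHomology_exists_heckeSelfAdjoint_perfectPairing)
    (hBuz : buzzard2000_multiplicityOne_gamma0) (hN : Odd N)
    (f : CuspForm (Gamma0 N) 2) (hf : IsNewform0 f) (A : ℕ → ℤ) (hA : ∀ p : ℕ, p.Prime → cuspCoeff f p = (A p : ℂ))
    (k : Type) [Field k] [IsAlgClosed k] [CharP k 2] [TopologicalSpace k] [DiscreteTopology k]
    (ρ : ModPGaloisRep ℚ k 2)
    (hρ : ∀ v : HeightOneSpectrum (𝓞 ℚ), ¬ ((primesEquiv v : Nat.Primes) : ℕ) ∣ 2 * N →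
      ρ.IsUnramifiedAt v ∧
        ρ.HasFrobCharpolyAt v
          (X ^ 2 - C (((A ((primesEquiv v : Nat.Primes) : ℕ) : ℤ) : k)) * X + C (((primesEquiv v : Nat.Primes) : ℕ) : k)))
    (hirr : FramedRep.IsIrreducible ρ)
    (h2 : ∀ v : HeightOneSpectrum (𝓞 ℚ), ((primesEquiv v : Nat.Primes) : ℕ) = 2 →
      ∀ 𝔓 ∈ v.primesAbove, ∃ σ ∈ 𝔓.decompositionSubgroup (Field.absoluteGaloisGroup ℚ),
        ∀ c : k, ((ρ σ : GL (Fin 2) k) : Matrix (Fin 2) (Fin 2) k) ≠ Matrix.scalar (Fin 2) c)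
    (s : Finset (Gamma0 N → ZMod 2))
    (hs : ∀ χ ∈ s, (∀ γ γ' : Gamma0 N, χ (γ * γ') = χ γ + χ γ') ∧
      (∀ γ γ' : Gamma0 N, periodFunctional N γ = periodFunctional N γ' → χ γ = χ γ') ∧
      (∀ (p : ℕ) (hp : p.Prime) (γ σ : Gamma0 N),
        periodFunctional N σ = (haveI : NeZero p := ⟨hp.ne_zero⟩; heckeT (Gamma0 N) 2 p).dualMap (periodFunctional N γ) →
        χ σ = ((A p : ℤ) : ZMod 2) * χ γ)) :
    s.card ≤ 4 := by
  classical
  obtain ⟨B, hBij, hAdj⟩ := hPair N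
  -- representatives
  have hrep : ∀ χ : Gamma0 N → ZMod 2, ∃ x₀ : periodHomologyHecke N, χ ∈ s →
      (∀ γ : Gamma0 N, χ γ = ((B x₀ ⟨periodFunctional N γ, periodFunctional_mem_periodHomology N γ⟩ : ℤ) : ZMod 2)) ∧
      ∀ (p : ℕ) (hp : p.Prime), ∃ y ∈ periodHomology N,
        (haveI : NeZero p := ⟨hp.ne_zero⟩; heckeT (Gamma0 N) 2 p).dualMap (x₀ : Module.Dual ℂ (CuspForm (Gamma0 N) 2))
          - ((A p : ℤ) : ℂ) • (x₀ : Module.Dual ℂ (CuspForm (Gamma0 N) 2)) = (2 : ℂ) • y := by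
    intro χ
    by_cases hχ : χ ∈ s
    · obtain ⟨a, b, c⟩ := hs χ hχ
      obtain ⟨x₀, h₁, h₂⟩ := exists_socleRep_of_pairing B hBij hAdj A χ a b c
      exact ⟨x₀, fun _ ↦ ⟨h₁, h₂⟩⟩
    · exact ⟨0, fun h ↦ absurd h hχ⟩
  choose X hX using hrep
  -- distinct characters have incongruent representatives
  have hcongr : ∀ χ ∈ s, ∀ χ' ∈ s, (∃ z ∈ periodHomology N,
      (X χ : Module.Dual ℂ (CuspForm (Gamma0 N) 2)) - X χ' = (2 : ℂ) • z) → χ = χ' := by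
    intro χ hχ χ' hχ' ⟨z, hz, hzz⟩
    have hsub : X χ - X χ' = (2 : ℤ) • (⟨z, (mem_periodHomologyHecke N).mpr hz⟩ : periodHomologyHecke N) := by
      apply Subtype.ext
      rw [Submodule.coe_sub, hzz, Submodule.coe_smul_of_tower, ← Int.cast_smul_eq_zsmul ℂ, Int.cast_ofNat]
    funext γ
    rw [(hX χ hχ).1 γ, (hX χ' hχ').1 γ]
    have h := congrArg (fun w ↦ B w ⟨periodFunctional N γ, periodFunctional_mem_periodHomology N γ⟩) hsub
    simp only [map_sub, AddMonoidHom.sub_apply, map_zsmul, AddMonoidHom.zsmul_apply, smul_eq_mul] at h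
    have h' : B (X χ) ⟨periodFunctional N γ, periodFunctional_mem_periodHomology N γ⟩ =
        B (X χ') ⟨periodFunctional N γ, periodFunctional_mem_periodHomology N γ⟩ +
          2 * B ⟨z, (mem_periodHomologyHecke N).mpr hz⟩ ⟨periodFunctional N γ, periodFunctional_mem_periodHomology N γ⟩ := by
      linarith
    rw [h']
    push_cast
    rw [show (2 : ZMod 2) = 0 from rfl, zero_mul, add_zero]
  -- the image finset
  let s' : Finset (Module.Dual ℂ (CuspForm (Gamma0 N) 2)) := s.image fun χ ↦ (X χ : Module.Dual ℂ (CuspForm (Gamma0 N) 2))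
  have hinj : Set.InjOn (fun χ ↦ (X χ : Module.Dual ℂ (CuspForm (Gamma0 N) 2))) s := by
    intro χ hχ χ' hχ' h
    exact hcongr χ hχ χ' hχ' ⟨0, (periodHomology N).zero_mem, by simp [h]⟩
  have hcard : s'.card = s.card := Finset.card_image_of_injOn hinj
  rw [← hcard]
  refine card_le_four_of_multiplicityOne hBuz hN f hf A hA k ρ hρ hirr h2 s' (fun x hx ↦ ?_) (fun x hx x' hx' hne ↦ ?_)
  · obtain ⟨χ, hχ, rfl⟩ := Finset.mem_image.mp hx
    exact ⟨(X χ).2, (hX χ hχ).2⟩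
  · obtain ⟨χ, hχ, rfl⟩ := Finset.mem_image.mp hx
    obtain ⟨χ', hχ', rfl⟩ := Finset.mem_image.mp hx'
    intro h
    exact hne (by rw [hcongr χ hχ χ' hχ' h])

end Represent

end MultOneDictionary

end Summit.BirchSwinnertonDyer.BirchSwinnertonDyer.Theorems.SignedMuAtTwo

end
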